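import Literature.Analysis.FluidPDE.PassiveScalarProofs
import Literature.Analysis.FunctionSpaces.TorusMollifierEstimates
import Literature.Analysis.FunctionSpaces.TorusSpectralWeakDerivative
import Literature.Analysis.FunctionSpaces.TorusTrigPoly
import HarnessLib

/-!
# Energy inequality for the passive scalar, I: the spectral gradient norm and slice estimates

Analysis/FluidPDE proof-support file, first of three serving the discharge of the named facts
`Literature.Analysis.FluidPDE.Torus.IsWeakScalarTransportOn.energy_ineq` and
`Literature.Analysis.FluidPDE.Torus.IsWeakScalarTransportOn.eScalarDissipation_le_variance` of `FluidPDE/PassiveScalar`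
(the energy inequality `2κ ∫₀ᵀ ‖∇θ‖²_{L²} ≤ ‖θ₀‖²_{L²}`, resp. `≤ Var θ₀`, for weak solutions of
`∂ₜθ + u·∇θ = κΔθ` on `T^d × [0,T)` with bounded drift; Bonicatto–Ciampa–Crippa 2023,
Thm. 3.3; Drivas–Elgindi–Iyer–Jeong 2022, (1.2)). This file contains the time-independent
ingredients, for a single time slice `δ = θ(s) ∈ L¹(T^d)`, an a.e.-bounded measurable weakly
divergence-free field `v = u(s)` and the torus mollifier `k = kernel ε` (`TorusMollifier`):

* **The spectral squared gradient norm of smooth scalars is the classical one**,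
  `eScalarGradNormSq A = ofReal (∫ ‖∇A‖²)` (`eScalarGradNormSq_eq_ofReal_integral`; Parseval for
  `∂ⱼA`, Grafakos 2014, Prop. 3.2.6 (8), Prop. 3.2.7 (3)); this **discharges** the named fact
  `Torus.scalarGradNormSq_eq_toReal` of `PassiveScalar` (`scalarGradNormSq_eq_toReal_holds`).
* **Lower semicontinuity under `L²` convergence**: if `Aₙ → θ` in `L²` then
  `eScalarGradNormSq θ ≤ liminfₙ eScalarGradNormSq Aₙ` (`(mul_)eScalarGradNormSq_le_liminf`;
  termwise convergence of Fourier coefficients, `‖𝓕f(k) - 𝓕g(k)‖ ≤ ‖f - g‖_{L²}`, and Fatou for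
  series with convergent terms, `Literature.Analysis.FluidPDE.tsum_le_liminf_tsum_of_tendsto`).
* Kernel lemmas: `∇k` is odd, `∂ⱼ(A ⋆ k) = ∂ⱼA ⋆ k`, Young for the gradient of a re-mollified
  function `‖∇(A ⋆ k)‖₂ ≤ ‖∇A‖₂`, and `‖δ - (δ ⋆ k) ⋆ k‖₂ ≤ 2‖δ ⋆ k - δ‖₂`.
* **The slice energy computation** for the mollified equation: with `A = δ ⋆ k`, `B = A ⋆ k` and
  the flux `G(x) = ∫ δ(y) (-⟪v y, ∇k(x-y)⟫ + κ Δk(x-y)) dy` (the right-hand side of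
  `∂ₜ(θ ⋆ k)`),
  `∫ A G = ∫ δ ⟪v, ∇B⟫ - κ ∫ ‖∇A‖²` (`integral_conv_mul_flux_eq`: Fubini, oddness of `∇k`, and
  `∫ A ΔA = -∫‖∇A‖²`), `∫ δ ⟪v, ∇B⟫ = ∫ (δ - B) ⟪v, ∇B⟫` by weak incompressibility
  (`∫ B⟪v, ∇B⟫ = 0`), whence the **slice energy inequality**
  `∫ A G + κ ∫‖∇A‖² ≤ ‖v‖_∞ · 2‖δ ⋆ k - δ‖₂ · ‖∇A‖₂` (`ofReal_integral_conv_mul_flux_add_le`).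

The last inequality replaces the commutator estimate of Bonicatto–Ciampa–Crippa 2023, Lemma 3.1
(`r^δ → 0` in `L²_t H⁻¹_x`) in the proof of their Thm. 3.3: the remainder of the mollified
energy balance is bounded by `‖θ ⋆ k_ε - θ‖_{L²}`, which tends to zero slice-wise without any
translation-continuity argument for the drift.

## Mathlib / tree search

Mathlib (this pin): Parseval on `UnitAddTorus` only for `Lp` elements
(`UnitAddTorus.hasSum_sq_mFourierCoeff`); no Sobolev/gradient norms on the torus, no
mollification on compact groups beyond `MeasureTheory.convolution` (searched `eHomSobolev`,
`gradient.*mFourierCoeff`, `convolution.*UnitAddTorus`: tree only). From the tree: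
`TorusFourierCalculus` (`mFourierCoeff_partialDeriv`, `hasSum_sq_mFourierCoeff_of_continuous`),
`TorusSpectralWeakDerivative` (`IsSmooth.ofReal_comp`, `partialDeriv_ofReal_comp`,
`enorm_sq_two_pi_I_mul`), `TorusTrigPoly` (`mFourierCoeff_sub`, `integral_mFourier`),
`TorusConvolution` / `TorusMollifier(Estimates)` (smoothing, derivative formulas, Young,
evenness of the kernel), `PassiveScalarProofs` (`continuous_fluxIntegral`,
`integral_mul_inner_gradient_eq_zero`, `ofReal_integral_mul_le_eLpNorm_mul`).

## References

* P. Bonicatto, G. Ciampa, G. Crippa, *Weak and parabolic solutions of advection–diffusion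
  equations with rough velocity field*, J. Evol. Equ. 24 (2024), Paper No. 1
  (arXiv:2306.15529), Lemma 3.1, Thm. 3.3 and its proof, (3.1)–(3.4). Bib key
  `BonicattoCiampaCrippa2023`.
* T. D. Drivas, T. M. Elgindi, G. Iyer, I.-J. Jeong, *Anomalous dissipation in passive scalar
  transport*, Arch. Ration. Mech. Anal. 243 (2022), 1151–1180, (1.1)–(1.2). Bib key `DEIJ2022`.
* L. Grafakos, *Classical Fourier Analysis*, 3rd ed., GTM 249 (2014), Prop. 3.2.6 (8),
  Prop. 3.2.7 (3). Bib key `Grafakos2014`.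
* L. C. Evans, *Partial Differential Equations*, 2nd ed. (AMS 2010), App. C.2 Thm. 3, App. C.4
  Thm. 7. Bib key `Evans2010`.
-/

noncomputable section

open MeasureTheory TopologicalSpace Set Function Filter Topology Metric ContinuousLinearMap
  UnitAddTorus
open scoped ENNReal NNReal Convolution ContDiff InnerProductSpace

namespace Literature.Analysis.FluidPDE

/-- **Fatou for series with convergent terms**: if `a n m → b m` for every `m`, then
`∑' b ≤ liminfₙ ∑' a n` in `ℝ≥0∞` (finite partial sums converge; `ENNReal.tsum_eq_iSup_sum`). [folklore] -/
theorem tsum_le_liminf_tsum_of_tendsto {β : Type*} {a : ℕ → β → ℝ≥0∞} {b : β → ℝ≥0∞}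
    (h : ∀ m, Tendsto (fun n => a n m) atTop (𝓝 (b m))) :
    ∑' m, b m ≤ liminf (fun n => ∑' m, a n m) atTop := by
  rw [ENNReal.tsum_eq_iSup_sum]
  refine iSup_le fun S => ?_
  have hS : Tendsto (fun n => ∑ m ∈ S, a n m) atTop (𝓝 (∑ m ∈ S, b m)) :=
    tendsto_finsetSum S fun m _ => h m
  rw [← hS.liminf_eq]
  exact liminf_le_liminf (Eventually.of_forall fun n => ENNReal.sum_le_tsum S)

namespace Torus

variable {d : Type*} [Fintype d]

/-! ## The spectral squared gradient norm of smooth and of rough scalars -/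

section Spectral

/-- `eScalarGradNormSq θ = 4π² ∑ₖ |k|² ‖𝓕(↑θ)(k)‖ₑ²` (the omitted zero mode of
`eHomSobolevSeminorm` has weight `|0|² = 0` anyway). [folklore] -/
theorem eScalarGradNormSq_eq_tsum (θ : UnitAddTorus d → ℝ) :
    eScalarGradNormSq θ = ENNReal.ofReal (4 * Real.pi ^ 2) *
      ∑' k : d → ℤ, ENNReal.ofReal (FunctionSpaces.Torus.freqNormSq k) * ‖mFourierCoeff (fun x => (θ x : ℂ)) k‖ₑ ^ 2 := by
  rw [eScalarGradNormSq, FunctionSpaces.Torus.eHomSobolevSeminorm, ENNReal.rpow_half_sq]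
  congr 1
  refine tsum_congr fun k => ?_
  by_cases hk : k = 0
  · subst hk
    simp [FunctionSpaces.Torus.freqNormSq]
  · rw [if_neg hk, Real.rpow_one]

variable [DecidableEq d] in
/-- Spectral first moment along one axis for a smooth real scalar:
`∑ₖ kⱼ² ‖𝓕(↑A)(k)‖ₑ² = ofReal ((4π²)⁻¹ ∫ (∂ⱼA)²)` (`𝓕(∂ⱼg) = 2πi kⱼ 𝓕g`, Grafakos 2014,
Prop. 3.2.6 (8), and Parseval, Prop. 3.2.7 (3)). [cite: Grafakos2014, Prop. 3.2.6 (8)] -/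
theorem tsum_sq_mul_enorm_sq_mFourierCoeff_ofReal {A : UnitAddTorus d → ℝ} (hA : FunctionSpaces.Torus.IsSmooth A) (j : d) :
    ∑' k : d → ℤ, ENNReal.ofReal ((k j : ℝ) ^ 2) * ‖mFourierCoeff (fun x => (A x : ℂ)) k‖ₑ ^ 2 =
      ENNReal.ofReal ((4 * Real.pi ^ 2)⁻¹ * ∫ x, (FunctionSpaces.Torus.partialDeriv j A x) ^ 2) := by
  set g : UnitAddTorus d → ℂ := fun x => (A x : ℂ) with hg_def
  have hg : FunctionSpaces.Torus.IsSmooth g := hA.ofReal_comp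
  have hparR := FunctionSpaces.Torus.hasSum_sq_mFourierCoeff_of_continuous (hg.partialDeriv j).continuous
  have hnorm : ∀ x, ‖FunctionSpaces.Torus.partialDeriv j g x‖ ^ 2 = (FunctionSpaces.Torus.partialDeriv j A x) ^ 2 := fun x => by
    rw [hg_def, FunctionSpaces.Torus.partialDeriv_ofReal_comp hA, Complex.norm_real, Real.norm_eq_abs, sq_abs]
  simp_rw [hnorm] at hparR
  have hpar : ∑' k : d → ℤ, ‖mFourierCoeff (FunctionSpaces.Torus.partialDeriv j g) k‖ₑ ^ 2 =
      ENNReal.ofReal (∫ x, (FunctionSpaces.Torus.partialDeriv j A x) ^ 2) := by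
    rw [← hparR.tsum_eq, ENNReal.ofReal_tsum_of_nonneg (fun k => sq_nonneg _) hparR.summable]
    refine tsum_congr fun k => ?_
    rw [← ofReal_norm, ← ENNReal.ofReal_pow (norm_nonneg _)]
  simp_rw [FunctionSpaces.Torus.mFourierCoeff_partialDeriv hg, enorm_smul, mul_pow, FunctionSpaces.enorm_sq_two_pi_I_mul, mul_assoc] at hpar
  rw [ENNReal.tsum_mul_left] at hpar
  have h4 : ENNReal.ofReal (4 * Real.pi ^ 2) ≠ 0 := by
    rw [Ne, ENNReal.ofReal_eq_zero, not_le]; positivity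
  rw [ENNReal.ofReal_mul (by positivity), ENNReal.ofReal_inv_of_pos (by positivity), ← hpar,
    ← mul_assoc, ENNReal.inv_mul_cancel h4 ENNReal.ofReal_ne_top, one_mul]

/-- **The spectral squared gradient norm of a smooth real scalar is its classical one**:
`eScalarGradNormSq A = ofReal (∫ ‖∇A‖²)` (Parseval for `∂ⱼA` and `‖∇A‖² = ∑ⱼ (∂ⱼA)²`;
Grafakos 2014, Prop. 3.2.6 (8), Prop. 3.2.7 (3)). [cite: Grafakos2014, Prop. 3.2.7 (3)] -/
theorem eScalarGradNormSq_eq_ofReal_integral {A : UnitAddTorus d → ℝ} (hA : FunctionSpaces.Torus.IsSmooth A) :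
    eScalarGradNormSq A = ENNReal.ofReal (∫ x, ‖FunctionSpaces.Torus.gradient A x‖ ^ 2) := by
  classical
  have hA1 : FunctionSpaces.Torus.IsContDiff 1 A := hA.isContDiff (by simp)
  have hsplit : ∀ k : d → ℤ, ENNReal.ofReal (FunctionSpaces.Torus.freqNormSq k) = ∑ j, ENNReal.ofReal ((k j : ℝ) ^ 2) :=
    fun k => by rw [FunctionSpaces.Torus.freqNormSq, ENNReal.ofReal_sum_of_nonneg fun j _ => sq_nonneg _]
  rw [eScalarGradNormSq_eq_tsum]
  simp_rw [hsplit, Finset.sum_mul]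
  rw [Summable.tsum_finsetSum fun j _ => ENNReal.summable]
  simp_rw [tsum_sq_mul_enorm_sq_mFourierCoeff_ofReal hA]
  rw [← ENNReal.ofReal_sum_of_nonneg fun j _ => by positivity, ← Finset.mul_sum,
    ← ENNReal.ofReal_mul (by positivity), ← mul_assoc, mul_inv_cancel₀ (by positivity), one_mul,
    ← integral_finsetSum _ (f := fun j x => FunctionSpaces.Torus.partialDeriv j A x ^ 2) fun j _ =>
      ((hA.partialDeriv j).continuous.pow 2).integrable_unitAddTorus]
  congr 1
  refine integral_congr_ae (Eventually.of_forall fun x => ?_)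
  dsimp only
  rw [EuclideanSpace.norm_sq_eq]
  refine Finset.sum_congr rfl fun j _ => ?_
  rw [FunctionSpaces.Torus.gradient_apply hA1, Real.norm_eq_abs, sq_abs]

/-- **Discharge** of the named fact `Torus.scalarGradNormSq_eq_toReal` (`PassiveScalar`): for
smooth `θ`, `∫ ‖∇θ‖² = (4π² ∑ₖ |k|² |θ̂(k)|²).toReal` (Grafakos 2014, Prop. 3.2.6 (8): for
`f ∈ C¹(Tⁿ)`, `𝓕(∂ⱼf)(m) = 2πi mⱼ f̂(m)`; with Parseval, Prop. 3.2.7 (3)). [cite: Grafakos2014, Prop. 3.2.6 (8)] -/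
theorem scalarGradNormSq_eq_toReal_holds : scalarGradNormSq_eq_toReal (d := d) := by
  intro θ hθ
  rw [eScalarGradNormSq_eq_ofReal_integral hθ, scalarGradNormSq,
    ENNReal.toReal_ofReal (integral_nonneg fun _ => sq_nonneg _)]

/-- For a smooth real scalar, `‖ x ↦ ‖∇A x‖ ‖²_{L²} = eScalarGradNormSq A`. [folklore] -/
theorem eLpNorm_norm_gradient_sq {A : UnitAddTorus d → ℝ} (hA : FunctionSpaces.Torus.IsSmooth A) :
    eLpNorm (fun x => ‖FunctionSpaces.Torus.gradient A x‖) 2 volume ^ 2 = eScalarGradNormSq A := by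
  rw [eScalarGradNormSq_eq_ofReal_integral hA, PassiveScalarProofs.eLpNorm_two_pow_two,
    ← lintegral_enorm_sq_eq_ofReal_integral_sq hA.gradient.continuous.norm]

/-- `‖𝓕f(k)‖ₑ ≤ ‖f‖_{L¹}` (the characters have modulus one). [folklore] -/
theorem enorm_mFourierCoeff_le_eLpNorm_one {F : Type*} [NormedAddCommGroup F] [NormedSpace ℂ F]
    (f : UnitAddTorus d → F) (k : d → ℤ) : ‖mFourierCoeff f k‖ₑ ≤ eLpNorm f 1 volume := by
  rw [FunctionSpaces.Torus.mFourierCoeff_eq_integral_volume, eLpNorm_one_eq_lintegral_enorm]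
  refine (enorm_integral_le_lintegral_enorm _).trans (lintegral_mono fun x => ?_)
  rw [enorm_smul]
  have h1 : ‖mFourier (-k) x‖ₑ ≤ 1 := by
    rw [← ofReal_norm, ← ENNReal.ofReal_one]
    exact ENNReal.ofReal_le_ofReal (((mFourier (-k)).norm_coe_le_norm x).trans_eq mFourier_norm)
  calc ‖mFourier (-k) x‖ₑ * ‖f x‖ₑ ≤ 1 * ‖f x‖ₑ := by gcongr
    _ = ‖f x‖ₑ := one_mul _

/-- Fourier coefficients are `L²`-Lipschitz: `‖𝓕(↑f)(k) - 𝓕(↑g)(k)‖ₑ ≤ ‖f - g‖_{L²}` for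
integrable real `f`, `g` on the probability space `T^d`. [folklore] -/
theorem enorm_mFourierCoeff_ofReal_sub_le {f g : UnitAddTorus d → ℝ} (hf : Integrable f volume)
    (hg : Integrable g volume) (k : d → ℤ) :
    ‖mFourierCoeff (fun x => (f x : ℂ)) k - mFourierCoeff (fun x => (g x : ℂ)) k‖ₑ ≤
      eLpNorm (f - g) 2 volume := by
  have hsub : (fun x => ((f x : ℝ) : ℂ)) - (fun x => ((g x : ℝ) : ℂ)) = fun x => (((f - g) x : ℝ) : ℂ) := by
    funext x
    simp
  rw [← FunctionSpaces.Torus.mFourierCoeff_sub hf.ofReal hg.ofReal, hsub]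
  refine (enorm_mFourierCoeff_le_eLpNorm_one _ k).trans ?_
  have hm : AEStronglyMeasurable (fun x => (((f - g) x : ℝ) : ℂ)) volume :=
    (hf.sub hg).ofReal.aestronglyMeasurable
  calc eLpNorm (fun x => (((f - g) x : ℝ) : ℂ)) 1 volume
      ≤ eLpNorm (fun x => (((f - g) x : ℝ) : ℂ)) 2 volume :=
        eLpNorm_le_eLpNorm_of_exponent_le (by norm_num) hm
    _ = eLpNorm (f - g) 2 volume :=
        eLpNorm_congr_norm_ae (Eventually.of_forall fun x => by
          rw [Complex.norm_real])

/-- **Lower semicontinuity of the spectral gradient norm under `L²` convergence**: if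
`Aₙ → θ` in `L²(T^d)` then `c · eScalarGradNormSq θ ≤ liminfₙ c · eScalarGradNormSq Aₙ` for every
finite constant `c` (termwise convergence of the Fourier coefficients and Fatou for series;
Robinson–Rodrigo–Sadowski 2016, Lemma 4.5 / (4.19): "norms are weakly lower semicontinuous",
Fourier-side form). [folklore] -/
theorem mul_eScalarGradNormSq_le_liminf {θ : UnitAddTorus d → ℝ} {A : ℕ → UnitAddTorus d → ℝ}
    (hθ : Integrable θ volume) (hA : ∀ n, Integrable (A n) volume)
    (hlim : Tendsto (fun n => eLpNorm (A n - θ) 2 volume) atTop (𝓝 0)) {c : ℝ≥0∞} (hc : c ≠ ⊤) :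
    c * eScalarGradNormSq θ ≤ liminf (fun n => c * eScalarGradNormSq (A n)) atTop := by
  have hcoef : ∀ k, Tendsto (fun n => mFourierCoeff (fun x => (A n x : ℂ)) k) atTop
      (𝓝 (mFourierCoeff (fun x => (θ x : ℂ)) k)) := by
    intro k
    rw [tendsto_iff_edist_tendsto_0]
    refine tendsto_of_tendsto_of_tendsto_of_le_of_le tendsto_const_nhds hlim (fun n => zero_le)
      fun n => ?_
    rw [edist_eq_enorm_sub]
    exact enorm_mFourierCoeff_ofReal_sub_le (hA n) hθ k
  simp_rw [eScalarGradNormSq_eq_tsum, ← ENNReal.tsum_mul_left]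
  refine tsum_le_liminf_tsum_of_tendsto fun k => ?_
  refine ENNReal.Tendsto.const_mul (ENNReal.Tendsto.const_mul (ENNReal.Tendsto.const_mul ?_
    (Or.inr ENNReal.ofReal_ne_top)) (Or.inr ENNReal.ofReal_ne_top)) (Or.inr hc)
  exact ((ENNReal.continuous_pow 2).tendsto _).comp (hcoef k).enorm

/-- `eScalarGradNormSq θ ≤ liminfₙ eScalarGradNormSq Aₙ` whenever `Aₙ → θ` in `L²(T^d)` (the case
`c = 1` of `mul_eScalarGradNormSq_le_liminf`). [folklore] -/
theorem eScalarGradNormSq_le_liminf {θ : UnitAddTorus d → ℝ} {A : ℕ → UnitAddTorus d → ℝ}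
    (hθ : Integrable θ volume) (hA : ∀ n, Integrable (A n) volume)
    (hlim : Tendsto (fun n => eLpNorm (A n - θ) 2 volume) atTop (𝓝 0)) :
    eScalarGradNormSq θ ≤ liminf (fun n => eScalarGradNormSq (A n)) atTop := by
  simpa only [one_mul] using mul_eScalarGradNormSq_le_liminf hθ hA hlim ENNReal.one_ne_top

end Spectral

/-! ## Kernel symmetry and the double mollification `B = (δ ⋆ k) ⋆ k` -/

section Kernel

variable {ε : ℝ}

/-- The gradient of the (even) torus kernel is odd: `∇k(x - y) = -∇k(y - x)`. [folklore] -/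
theorem gradient_kernel_sub_comm (hε : 0 < ε) (hε' : ε ≤ 1 / 4) (x y : UnitAddTorus d) :
    FunctionSpaces.Torus.gradient (FunctionSpaces.Torus.kernel ε) (x - y) = -FunctionSpaces.Torus.gradient (FunctionSpaces.Torus.kernel ε) (y - x) := by
  classical
  have hk1 : FunctionSpaces.Torus.IsContDiff 1 (FunctionSpaces.Torus.kernel (d := d) ε) := (FunctionSpaces.Torus.isSmooth_kernel hε hε').isContDiff (by simp)
  ext j
  rw [FunctionSpaces.Torus.gradient_apply hk1, FunctionSpaces.Torus.partialDeriv_kernel_sub_comm hε hε']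
  simp [FunctionSpaces.Torus.gradient_apply hk1]

variable {δ : UnitAddTorus d → ℝ}

/-- `∂ⱼ ((A ⋆ k)) = (∂ⱼ A) ⋆ k` for smooth `A` and the torus kernel (commutativity of real
convolution on the abelian torus and `∂ⱼ (k ⋆ A) = k ⋆ ∂ⱼ A`). [folklore] -/
theorem partialDeriv_conv_kernel_eq [DecidableEq d] {A : UnitAddTorus d → ℝ} (hA : FunctionSpaces.Torus.IsSmooth A)
    (hε : 0 < ε) (hε' : ε ≤ 1 / 4) (j : d) (y : UnitAddTorus d) :
    FunctionSpaces.Torus.partialDeriv j (A ⋆ FunctionSpaces.Torus.kernel ε) y = (FunctionSpaces.Torus.partialDeriv j A ⋆ FunctionSpaces.Torus.kernel ε) y := by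
  have hki : Integrable (FunctionSpaces.Torus.kernel (d := d) ε) volume := (FunctionSpaces.Torus.isSmooth_kernel hε hε').integrable
  rw [FunctionSpaces.Torus.convolution_comm_real A, FunctionSpaces.Torus.partialDeriv_convolution hki hA, FunctionSpaces.Torus.convolution_comm_real]

/-- **Young for the gradient of a re-mollified smooth function**:
`‖∇(A ⋆ k)‖_{L²} ≤ ‖∇A‖_{L²}` (componentwise `∂ⱼ(A ⋆ k) = ∂ⱼA ⋆ k`, `‖k‖_{L¹} = 1`). [folklore] -/
theorem eLpNorm_norm_gradient_conv_kernel_le {A : UnitAddTorus d → ℝ} (hA : FunctionSpaces.Torus.IsSmooth A)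
    (hε : 0 < ε) (hε' : ε ≤ 1 / 4) :
    eLpNorm (fun y => ‖FunctionSpaces.Torus.gradient (A ⋆ FunctionSpaces.Torus.kernel ε) y‖) 2 volume ≤
      eLpNorm (fun x => ‖FunctionSpaces.Torus.gradient A x‖) 2 volume := by
  classical
  have hk : FunctionSpaces.Torus.IsSmooth (FunctionSpaces.Torus.kernel (d := d) ε) := FunctionSpaces.Torus.isSmooth_kernel hε hε'
  have hB : FunctionSpaces.Torus.IsSmooth (A ⋆ FunctionSpaces.Torus.kernel ε) := FunctionSpaces.Torus.isSmooth_convolution hA.integrable hk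
  have hA1 : FunctionSpaces.Torus.IsContDiff 1 A := hA.isContDiff (by simp)
  have hB1 : FunctionSpaces.Torus.IsContDiff 1 (A ⋆ FunctionSpaces.Torus.kernel ε) := hB.isContDiff (by simp)
  -- squared norms as sums over components
  have hsq : ∀ {C : UnitAddTorus d → ℝ} (hC : FunctionSpaces.Torus.IsSmooth C),
      eLpNorm (fun y => ‖FunctionSpaces.Torus.gradient C y‖) 2 volume ^ 2 =
        ∑ j, eLpNorm (FunctionSpaces.Torus.partialDeriv j C) 2 volume ^ 2 := by
    intro C hC
    have hC1 : FunctionSpaces.Torus.IsContDiff 1 C := hC.isContDiff (by simp)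
    rw [PassiveScalarProofs.eLpNorm_two_pow_two]
    simp_rw [PassiveScalarProofs.eLpNorm_two_pow_two, enorm_norm]
    rw [← lintegral_finsetSum _ fun j _ => (hC.partialDeriv j).continuous.measurable.enorm.pow_const 2]
    refine lintegral_congr fun y => ?_
    rw [← ofReal_norm, ← ENNReal.ofReal_pow (norm_nonneg _), EuclideanSpace.norm_sq_eq,
      ENNReal.ofReal_sum_of_nonneg fun j _ => sq_nonneg _]
    refine Finset.sum_congr rfl fun j _ => ?_
    rw [FunctionSpaces.Torus.gradient_apply hC1, ← ofReal_norm, ← ENNReal.ofReal_pow (norm_nonneg _)]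
  rw [← ENNReal.pow_le_pow_left_iff two_ne_zero, hsq hB, hsq hA]
  refine Finset.sum_le_sum fun j _ => ?_
  rw [ENNReal.pow_le_pow_left_iff two_ne_zero]
  have hfun : FunctionSpaces.Torus.partialDeriv j (A ⋆ FunctionSpaces.Torus.kernel ε) = FunctionSpaces.Torus.partialDeriv j A ⋆ FunctionSpaces.Torus.kernel ε :=
    funext (partialDeriv_conv_kernel_eq hA hε hε' j)
  rw [hfun]
  calc eLpNorm (FunctionSpaces.Torus.partialDeriv j A ⋆ FunctionSpaces.Torus.kernel ε) 2 volume
      ≤ (∫⁻ y, ‖FunctionSpaces.Torus.kernel ε y‖ₑ) * eLpNorm (FunctionSpaces.Torus.partialDeriv j A) 2 volume :=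
        FunctionSpaces.Torus.eLpNorm_convolution_le (hA.partialDeriv j).continuous.aestronglyMeasurable
          hk.continuous.aestronglyMeasurable one_le_two
    _ = eLpNorm (FunctionSpaces.Torus.partialDeriv j A) 2 volume := by rw [FunctionSpaces.Torus.lintegral_enorm_kernel hε hε', one_mul]

/-- `‖δ - (δ ⋆ k) ⋆ k‖_{L²} ≤ 2 ‖δ ⋆ k - δ‖_{L²}` for integrable `δ`
(`δ - B = (δ - A) + (δ - A) ⋆ k` and Young with `‖k‖_{L¹} = 1`). [folklore] -/
theorem eLpNorm_sub_conv_conv_le (hδ : Integrable δ volume) (hε : 0 < ε) (hε' : ε ≤ 1 / 4) :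
    eLpNorm (δ - (δ ⋆ FunctionSpaces.Torus.kernel ε) ⋆ FunctionSpaces.Torus.kernel ε) 2 volume ≤ 2 * eLpNorm (δ ⋆ FunctionSpaces.Torus.kernel ε - δ) 2 volume := by
  have hk : FunctionSpaces.Torus.IsSmooth (FunctionSpaces.Torus.kernel (d := d) ε) := FunctionSpaces.Torus.isSmooth_kernel hε hε'
  have hAi : Integrable (δ ⋆ FunctionSpaces.Torus.kernel ε) volume := (FunctionSpaces.Torus.isSmooth_convolution hδ hk).integrable
  have hdec : δ - (δ ⋆ FunctionSpaces.Torus.kernel ε) ⋆ FunctionSpaces.Torus.kernel ε = (δ - δ ⋆ FunctionSpaces.Torus.kernel ε) + (δ - δ ⋆ FunctionSpaces.Torus.kernel ε) ⋆ FunctionSpaces.Torus.kernel ε := by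
    rw [FunctionSpaces.Torus.sub_convolution hδ hAi hk.continuous]
    abel
  have hm : AEStronglyMeasurable (δ - δ ⋆ FunctionSpaces.Torus.kernel ε) volume :=
    hδ.aestronglyMeasurable.sub hAi.aestronglyMeasurable
  have hmc : AEStronglyMeasurable ((δ - δ ⋆ FunctionSpaces.Torus.kernel ε) ⋆ FunctionSpaces.Torus.kernel ε) volume :=
    (FunctionSpaces.Torus.continuous_convolution (hδ.sub hAi) hk.continuous).aestronglyMeasurable
  rw [hdec]
  calc eLpNorm ((δ - δ ⋆ FunctionSpaces.Torus.kernel ε) + (δ - δ ⋆ FunctionSpaces.Torus.kernel ε) ⋆ FunctionSpaces.Torus.kernel ε) 2 volume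
      ≤ eLpNorm (δ - δ ⋆ FunctionSpaces.Torus.kernel ε) 2 volume + eLpNorm ((δ - δ ⋆ FunctionSpaces.Torus.kernel ε) ⋆ FunctionSpaces.Torus.kernel ε) 2 volume :=
        eLpNorm_add_le hm hmc one_le_two
    _ ≤ eLpNorm (δ - δ ⋆ FunctionSpaces.Torus.kernel ε) 2 volume + (∫⁻ y, ‖FunctionSpaces.Torus.kernel ε y‖ₑ) * eLpNorm (δ - δ ⋆ FunctionSpaces.Torus.kernel ε) 2 volume := by
        gcongr
        exact FunctionSpaces.Torus.eLpNorm_convolution_le hm hk.continuous.aestronglyMeasurable one_le_two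
    _ = 2 * eLpNorm (δ ⋆ FunctionSpaces.Torus.kernel ε - δ) 2 volume := by
        rw [FunctionSpaces.Torus.lintegral_enorm_kernel hε hε', one_mul, eLpNorm_sub_comm, two_mul]

end Kernel

/-! ## The slice energy computation for bounded, weakly divergence-free drifts -/

section Slice

variable {δ : UnitAddTorus d → ℝ} {v : UnitAddTorus d → EuclideanSpace ℝ d} {ε Cv : ℝ}

/-- An a.e. bound on `‖v‖` on `T^d` read on the second factor of `T^d × T^d`. [folklore] -/
theorem ae_prod_snd_norm_le (hCv : ∀ᵐ y ∂(volume : Measure (UnitAddTorus d)), ‖v y‖ ≤ Cv) :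
    ∀ᵐ p : UnitAddTorus d × UnitAddTorus d ∂((volume : Measure (UnitAddTorus d)).prod volume),
      ‖v p.2‖ ≤ Cv :=
  (Measure.quasiMeasurePreserving_snd (μ := (volume : Measure (UnitAddTorus d)))
    (ν := (volume : Measure (UnitAddTorus d)))).ae hCv

/-- `‖v‖ |δ|` is integrable for `δ ∈ L¹` and a.e.-bounded measurable `v`. [folklore] -/
theorem integrable_norm_mul_of_ae_le (hδ : Integrable δ volume) (hv : AEStronglyMeasurable v volume)
    (hCv : ∀ᵐ y ∂volume, ‖v y‖ ≤ Cv) : Integrable (fun y => ‖v y‖ * δ y) volume :=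
  hδ.bdd_mul hv.norm (hCv.mono fun y hy => by simpa using hy)

/-- **The transport pairing of a slice, swapped onto the double mollification.** For
`δ ∈ L¹`, a.e.-bounded measurable `v` and the torus kernel `k = kernel ε`:
`∫ A(x) (∫ δ(y) ⟪v(y), ∇k(x - y)⟫ dy) dx = -∫ δ(y) ⟪v(y), ∇B(y)⟫ dy` with `A = δ ⋆ k`,
`B = A ⋆ k` (Fubini; `∇k` is odd, so `∫ A(x) ∇k(x - y) dx = -(A ⋆ ∇k)(y) = -∇B(y)`). [folklore] -/
theorem integral_conv_mul_transport_eq (hδ : Integrable δ volume) (hv : AEStronglyMeasurable v volume)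
    (hCv : ∀ᵐ y ∂volume, ‖v y‖ ≤ Cv) (hε : 0 < ε) (hε' : ε ≤ 1 / 4) :
    ∫ x, (δ ⋆ FunctionSpaces.Torus.kernel ε) x * ∫ y, δ y * ⟪v y, FunctionSpaces.Torus.gradient (FunctionSpaces.Torus.kernel ε) (x - y)⟫_ℝ =
      -∫ y, δ y * ⟪v y, FunctionSpaces.Torus.gradient ((δ ⋆ FunctionSpaces.Torus.kernel ε) ⋆ FunctionSpaces.Torus.kernel ε) y⟫_ℝ := by
  set k : UnitAddTorus d → ℝ := FunctionSpaces.Torus.kernel ε with hk_def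
  have hk : FunctionSpaces.Torus.IsSmooth k := FunctionSpaces.Torus.isSmooth_kernel hε hε'
  set A : UnitAddTorus d → ℝ := δ ⋆ k with hA_def
  have hA : FunctionSpaces.Torus.IsSmooth A := FunctionSpaces.Torus.isSmooth_convolution hδ hk
  have hAi : Integrable A volume := hA.integrable
  obtain ⟨CA, hCA⟩ := FunctionSpaces.Torus.exists_forall_norm_le_of_continuous hA.continuous
  obtain ⟨Ck, hCk⟩ := FunctionSpaces.Torus.exists_forall_norm_le_of_continuous hk.gradient.continuous
  -- the integrand on `T^d × T^d` and its integrability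
  set F : UnitAddTorus d → UnitAddTorus d → ℝ := fun x y =>
    A x * (δ y * ⟪v y, FunctionSpaces.Torus.gradient k (x - y)⟫_ℝ) with hF_def
  have hgc : Continuous fun p : UnitAddTorus d × UnitAddTorus d => FunctionSpaces.Torus.gradient k (p.1 - p.2) :=
    hk.gradient.continuous.comp (continuous_fst.sub continuous_snd)
  have hFm : AEStronglyMeasurable (uncurry F) ((volume : Measure (UnitAddTorus d)).prod volume) := by
    refine ((hA.continuous.comp continuous_fst).aestronglyMeasurable).mul
      ((hδ.aestronglyMeasurable.comp_snd).mul ((hv.comp_snd).inner hgc.aestronglyMeasurable))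
  have hFi : Integrable (uncurry F) ((volume : Measure (UnitAddTorus d)).prod volume) := by
    refine Integrable.mono' (g := fun p : UnitAddTorus d × UnitAddTorus d => CA * (Cv * Ck) * ‖δ p.2‖)
      (((integrable_const (CA * (Cv * Ck))).mul_prod hδ.norm)) hFm ?_
    filter_upwards [ae_prod_snd_norm_le hCv] with p hp
    simp only [uncurry, hF_def, norm_mul, Real.norm_eq_abs]
    have h1 : |⟪v p.2, FunctionSpaces.Torus.gradient k (p.1 - p.2)⟫_ℝ| ≤ Cv * Ck :=
      (abs_real_inner_le_norm _ _).trans (mul_le_mul hp (hCk _) (norm_nonneg _)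
        ((norm_nonneg _).trans hp))
    have h2 : |A p.1| ≤ CA := by simpa [Real.norm_eq_abs] using hCA p.1
    have hCA0 : 0 ≤ CA := (abs_nonneg _).trans h2
    calc |A p.1| * (|δ p.2| * |⟪v p.2, FunctionSpaces.Torus.gradient k (p.1 - p.2)⟫_ℝ|)
        ≤ CA * (|δ p.2| * (Cv * Ck)) := by gcongr
      _ = CA * (Cv * Ck) * |δ p.2| := by ring
  -- swap the integrals
  have hswap := integral_integral_swap hFi
  have hlhs : ∫ x, A x * ∫ y, δ y * ⟪v y, FunctionSpaces.Torus.gradient k (x - y)⟫_ℝ = ∫ x, ∫ y, F x y := by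
    refine integral_congr_ae (Eventually.of_forall fun x => ?_)
    simp only [hF_def]
    exact (MeasureTheory.integral_const_mul _ _).symm
  rw [hlhs, hswap]
  -- the inner `x`-integral: `∫ A(x) ∇k(x - y) dx = -∇B(y)`
  have hinner : ∀ y, ∫ x, F x y = -(δ y * ⟪v y, FunctionSpaces.Torus.gradient (A ⋆ k) y⟫_ℝ) := by
    intro y
    have hint : Integrable (fun x => A x • FunctionSpaces.Torus.gradient k (y - x)) volume :=
      FunctionSpaces.Torus.integrable_smul_comp_sub hAi hk.gradient.continuous y
    have e1 : ∀ x, F x y = -(δ y * ⟪v y, A x • FunctionSpaces.Torus.gradient k (y - x)⟫_ℝ) := fun x => by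
      simp only [hF_def]
      rw [gradient_kernel_sub_comm hε hε' x y, inner_neg_right, real_inner_smul_right]
      ring
    simp_rw [e1]
    rw [integral_neg, MeasureTheory.integral_const_mul, integral_inner hint,
      FunctionSpaces.Torus.gradient_convolution hAi hk y, convolution_lsmul]
  simp_rw [hinner]
  rw [integral_neg]

/-- **The flux pairing of a slice.** With `G(x) = ∫ δ(y) (-⟪v y, ∇k(x-y)⟫ + κ Δk(x-y)) dy`
(the right-hand side of the mollified equation), `A = δ ⋆ k`, `B = A ⋆ k`:
`∫ A G = ∫ δ ⟪v, ∇B⟫ - κ ∫ ‖∇A‖²` (`∫ A ΔA = -∫ ‖∇A‖²`, Evans, App. C.2, Thm. 3). [folklore] -/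
theorem integral_conv_mul_flux_eq (hδ : Integrable δ volume) (hv : AEStronglyMeasurable v volume)
    (hCv : ∀ᵐ y ∂volume, ‖v y‖ ≤ Cv) (hε : 0 < ε) (hε' : ε ≤ 1 / 4) (κ : ℝ) :
    ∫ x, (δ ⋆ FunctionSpaces.Torus.kernel ε) x * ∫ y, δ y *
        (-⟪v y, FunctionSpaces.Torus.gradient (FunctionSpaces.Torus.kernel ε) (x - y)⟫_ℝ + κ * FunctionSpaces.Torus.laplacian (FunctionSpaces.Torus.kernel ε) (x - y)) =
      (∫ y, δ y * ⟪v y, FunctionSpaces.Torus.gradient ((δ ⋆ FunctionSpaces.Torus.kernel ε) ⋆ FunctionSpaces.Torus.kernel ε) y⟫_ℝ) -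
        κ * ∫ x, ‖FunctionSpaces.Torus.gradient (δ ⋆ FunctionSpaces.Torus.kernel ε) x‖ ^ 2 := by
  classical
  set k : UnitAddTorus d → ℝ := FunctionSpaces.Torus.kernel ε with hk_def
  have hk : FunctionSpaces.Torus.IsSmooth k := FunctionSpaces.Torus.isSmooth_kernel hε hε'
  set A : UnitAddTorus d → ℝ := δ ⋆ k with hA_def
  have hA : FunctionSpaces.Torus.IsSmooth A := FunctionSpaces.Torus.isSmooth_convolution hδ hk
  have hA1 : FunctionSpaces.Torus.IsContDiff 1 A := hA.isContDiff (by simp)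
  have hvδ : Integrable (fun y => ‖v y‖ * δ y) volume := integrable_norm_mul_of_ae_le hδ hv hCv
  -- the flux and its transport part are continuous in `x`
  have hGc : Continuous fun x => ∫ y, δ y *
      (-⟪v y, FunctionSpaces.Torus.gradient k (x - y)⟫_ℝ + κ * FunctionSpaces.Torus.laplacian k (x - y)) :=
    continuous_fluxIntegral hδ hv hvδ hk κ
  have hIc : Continuous fun x => ∫ y, δ y * ⟪v y, FunctionSpaces.Torus.gradient k (x - y)⟫_ℝ := by
    have h0 := continuous_fluxIntegral hδ hv hvδ hk 0
    have e : (fun x => ∫ y, δ y * ⟪v y, FunctionSpaces.Torus.gradient k (x - y)⟫_ℝ) =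
        fun x => -∫ y, δ y * (-⟪v y, FunctionSpaces.Torus.gradient k (x - y)⟫_ℝ + 0 * FunctionSpaces.Torus.laplacian k (x - y)) := by
      funext x
      rw [← integral_neg]
      refine integral_congr_ae (Eventually.of_forall fun y => ?_)
      ring
    rw [e]
    exact h0.neg
  -- pointwise splitting of the flux: `G = -I + κ ΔA`
  obtain ⟨Ck, hCk⟩ := FunctionSpaces.Torus.exists_forall_norm_le_of_continuous hk.gradient.continuous
  obtain ⟨Cl, hCl⟩ := FunctionSpaces.Torus.exists_forall_norm_le_of_continuous hk.laplacian.continuous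
  have hsplit : ∀ x, ∫ y, δ y * (-⟪v y, FunctionSpaces.Torus.gradient k (x - y)⟫_ℝ + κ * FunctionSpaces.Torus.laplacian k (x - y)) =
      -(∫ y, δ y * ⟪v y, FunctionSpaces.Torus.gradient k (x - y)⟫_ℝ) + κ * FunctionSpaces.Torus.laplacian A x := by
    intro x
    have i1 : Integrable (fun y => δ y * ⟪v y, FunctionSpaces.Torus.gradient k (x - y)⟫_ℝ) volume := by
      refine hδ.mul_bdd (c := Cv * Ck)
        (hv.inner (hk.gradient.continuous.comp (continuous_const.sub continuous_id)).aestronglyMeasurable) ?_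
      filter_upwards [hCv] with y hy
      rw [Real.norm_eq_abs]
      exact (abs_real_inner_le_norm _ _).trans (mul_le_mul hy (hCk _) (norm_nonneg _)
        ((norm_nonneg _).trans hy))
    have i2 : Integrable (fun y => δ y * FunctionSpaces.Torus.laplacian k (x - y)) volume :=
      hδ.mul_bdd (c := Cl) (hk.laplacian.continuous.comp (continuous_const.sub continuous_id)).aestronglyMeasurable
        (Eventually.of_forall fun y => hCl _)
    have hlap : FunctionSpaces.Torus.laplacian A x = ∫ y, δ y * FunctionSpaces.Torus.laplacian k (x - y) := by
      rw [hA_def, FunctionSpaces.Torus.laplacian_convolution hδ hk, convolution_lsmul]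
      rfl
    rw [hlap, ← integral_neg, ← MeasureTheory.integral_const_mul, ← integral_add i1.fun_neg (i2.const_mul κ)]
    refine integral_congr_ae (Eventually.of_forall fun y => ?_)
    ring
  simp_rw [hsplit]
  have j1 : Integrable (fun x => A x * ∫ y, δ y * ⟪v y, FunctionSpaces.Torus.gradient k (x - y)⟫_ℝ) volume :=
    (hA.continuous.mul hIc).integrable_unitAddTorus
  have j2 : Integrable (fun x => κ * (A x * FunctionSpaces.Torus.laplacian A x)) volume :=
    (continuous_const.mul (hA.continuous.mul hA.laplacian.continuous)).integrable_unitAddTorus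
  have e : ∫ x, A x * (-(∫ y, δ y * ⟪v y, FunctionSpaces.Torus.gradient k (x - y)⟫_ℝ) + κ * FunctionSpaces.Torus.laplacian A x) =
      -(∫ x, A x * ∫ y, δ y * ⟪v y, FunctionSpaces.Torus.gradient k (x - y)⟫_ℝ) + κ * ∫ x, A x * FunctionSpaces.Torus.laplacian A x := by
    rw [← integral_neg, ← MeasureTheory.integral_const_mul, ← integral_add j1.fun_neg j2]
    refine integral_congr_ae (Eventually.of_forall fun x => ?_)
    ring
  rw [e, integral_conv_mul_transport_eq hδ hv hCv hε hε', neg_neg, FunctionSpaces.Torus.integral_mul_laplacian_eq_neg_sum hA hA]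
  -- `∑ⱼ ∫ (∂ⱼA)² = ∫ ‖∇A‖²`
  have hgrad : ∑ j, ∫ x, FunctionSpaces.Torus.partialDeriv j A x * FunctionSpaces.Torus.partialDeriv j A x = ∫ x, ‖FunctionSpaces.Torus.gradient A x‖ ^ 2 := by
    rw [← integral_finsetSum _ (f := fun j x => FunctionSpaces.Torus.partialDeriv j A x * FunctionSpaces.Torus.partialDeriv j A x) fun j _ =>
      ((hA.partialDeriv j).continuous.mul (hA.partialDeriv j).continuous).integrable_unitAddTorus]
    refine integral_congr_ae (Eventually.of_forall fun x => ?_)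
    dsimp only
    rw [EuclideanSpace.norm_sq_eq]
    refine Finset.sum_congr rfl fun j _ => ?_
    rw [FunctionSpaces.Torus.gradient_apply hA1, Real.norm_eq_abs, sq_abs, sq]
  rw [hgrad]
  ring

/-- **Weak incompressibility removes the smooth part of the transport pairing**:
`∫ δ ⟪v, ∇B⟫ = ∫ (δ - B) ⟪v, ∇B⟫` for smooth `B` and weakly divergence-free `v`
(`∫ B ⟪v, ∇B⟫ = ½ ∫ ⟪v, ∇(B²)⟫ = 0`). [folklore] -/
theorem integral_mul_inner_gradient_eq_integral_sub_mul (hδ : Integrable δ volume)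
    (hv : AEStronglyMeasurable v volume) (hCv : ∀ᵐ y ∂volume, ‖v y‖ ≤ Cv) (hdiv : FunctionSpaces.Torus.IsWeaklyDivFree v)
    {B : UnitAddTorus d → ℝ} (hB : FunctionSpaces.Torus.IsSmooth B) :
    ∫ y, δ y * ⟪v y, FunctionSpaces.Torus.gradient B y⟫_ℝ = ∫ y, (δ - B) y * ⟪v y, FunctionSpaces.Torus.gradient B y⟫_ℝ := by
  obtain ⟨Cg, hCg⟩ := FunctionSpaces.Torus.exists_forall_norm_le_of_continuous hB.gradient.continuous
  have hbd : ∀ᵐ y ∂volume, ‖⟪v y, FunctionSpaces.Torus.gradient B y⟫_ℝ‖ ≤ Cv * Cg := by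
    filter_upwards [hCv] with y hy
    rw [Real.norm_eq_abs]
    exact (abs_real_inner_le_norm _ _).trans (mul_le_mul hy (hCg _) (norm_nonneg _)
      ((norm_nonneg _).trans hy))
  have hm : AEStronglyMeasurable (fun y => ⟪v y, FunctionSpaces.Torus.gradient B y⟫_ℝ) volume :=
    hv.inner hB.gradient.continuous.aestronglyMeasurable
  have i1 : Integrable (fun y => δ y * ⟪v y, FunctionSpaces.Torus.gradient B y⟫_ℝ) volume := hδ.mul_bdd hm hbd
  have i2 : Integrable (fun y => B y * ⟪v y, FunctionSpaces.Torus.gradient B y⟫_ℝ) volume := hB.integrable.mul_bdd hm hbd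
  simp_rw [Pi.sub_apply, sub_mul]
  rw [integral_sub i1 i2, integral_mul_inner_gradient_eq_zero hB hdiv, sub_zero]

/-- **The slice energy inequality for bounded drifts** (the mollified energy balance of
Bonicatto–Ciampa–Crippa 2023, proof of Thm. 3.3, (3.1), with the remainder rewritten through
weak incompressibility instead of a commutator): for `δ ∈ L¹(T^d)`, an a.e.-bounded,
measurable, weakly divergence-free `v`, `k = kernel ε`, `A = δ ⋆ k`, and the flux
`G(x) = ∫ δ(y) (-⟪v y, ∇k(x-y)⟫ + κ Δk(x-y)) dy`,
`∫ A G + κ ∫ ‖∇A‖² ≤ ‖v‖_∞ · 2‖δ ⋆ k - δ‖_{L²} · ‖∇A‖_{L²}` (in `ℝ≥0∞`). [folklore] -/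
theorem ofReal_integral_conv_mul_flux_add_le (hδ : Integrable δ volume) (hv : AEStronglyMeasurable v volume)
    (hCv : ∀ᵐ y ∂volume, ‖v y‖ ≤ Cv) (hdiv : FunctionSpaces.Torus.IsWeaklyDivFree v) (hε : 0 < ε) (hε' : ε ≤ 1 / 4) (κ : ℝ) :
    ENNReal.ofReal ((∫ x, (δ ⋆ FunctionSpaces.Torus.kernel ε) x * ∫ y, δ y *
        (-⟪v y, FunctionSpaces.Torus.gradient (FunctionSpaces.Torus.kernel ε) (x - y)⟫_ℝ + κ * FunctionSpaces.Torus.laplacian (FunctionSpaces.Torus.kernel ε) (x - y))) +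
        κ * ∫ x, ‖FunctionSpaces.Torus.gradient (δ ⋆ FunctionSpaces.Torus.kernel ε) x‖ ^ 2) ≤
      ENNReal.ofReal Cv * (2 * eLpNorm (δ ⋆ FunctionSpaces.Torus.kernel ε - δ) 2 volume) *
        eLpNorm (fun x => ‖FunctionSpaces.Torus.gradient (δ ⋆ FunctionSpaces.Torus.kernel ε) x‖) 2 volume := by
  have hk : FunctionSpaces.Torus.IsSmooth (FunctionSpaces.Torus.kernel (d := d) ε) := FunctionSpaces.Torus.isSmooth_kernel hε hε'
  have hA : FunctionSpaces.Torus.IsSmooth (δ ⋆ FunctionSpaces.Torus.kernel ε) := FunctionSpaces.Torus.isSmooth_convolution hδ hk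
  have hB : FunctionSpaces.Torus.IsSmooth ((δ ⋆ FunctionSpaces.Torus.kernel ε) ⋆ FunctionSpaces.Torus.kernel ε) := FunctionSpaces.Torus.isSmooth_convolution hA.integrable hk
  rw [integral_conv_mul_flux_eq hδ hv hCv hε hε' κ, sub_add_cancel,
    integral_mul_inner_gradient_eq_integral_sub_mul hδ hv hCv hdiv hB]
  have hsm : AEStronglyMeasurable (δ - (δ ⋆ FunctionSpaces.Torus.kernel ε) ⋆ FunctionSpaces.Torus.kernel ε) volume :=
    hδ.aestronglyMeasurable.sub hB.continuous.aestronglyMeasurable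
  have hrm : AEStronglyMeasurable (fun y => ⟪v y, FunctionSpaces.Torus.gradient ((δ ⋆ FunctionSpaces.Torus.kernel ε) ⋆ FunctionSpaces.Torus.kernel ε) y⟫_ℝ) volume :=
    hv.inner hB.gradient.continuous.aestronglyMeasurable
  refine (ofReal_integral_mul_le_eLpNorm_mul hsm hrm).trans ?_
  have h1 : eLpNorm (fun y => ⟪v y, FunctionSpaces.Torus.gradient ((δ ⋆ FunctionSpaces.Torus.kernel ε) ⋆ FunctionSpaces.Torus.kernel ε) y⟫_ℝ) 2 volume ≤
      ENNReal.ofReal Cv * eLpNorm (fun y => ‖FunctionSpaces.Torus.gradient ((δ ⋆ FunctionSpaces.Torus.kernel ε) ⋆ FunctionSpaces.Torus.kernel ε) y‖) 2 volume := by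
    refine eLpNorm_le_mul_eLpNorm_of_ae_le_mul ?_ 2
    filter_upwards [hCv] with y hy
    rw [Real.norm_eq_abs, norm_norm]
    exact (abs_real_inner_le_norm _ _).trans (mul_le_mul_of_nonneg_right hy (norm_nonneg _))
  have h2 := eLpNorm_norm_gradient_conv_kernel_le hA hε hε'
  have h3 := eLpNorm_sub_conv_conv_le hδ hε hε'
  calc eLpNorm (δ - (δ ⋆ FunctionSpaces.Torus.kernel ε) ⋆ FunctionSpaces.Torus.kernel ε) 2 volume *
        eLpNorm (fun y => ⟪v y, FunctionSpaces.Torus.gradient ((δ ⋆ FunctionSpaces.Torus.kernel ε) ⋆ FunctionSpaces.Torus.kernel ε) y⟫_ℝ) 2 volume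
      ≤ (2 * eLpNorm (δ ⋆ FunctionSpaces.Torus.kernel ε - δ) 2 volume) *
        (ENNReal.ofReal Cv * eLpNorm (fun x => ‖FunctionSpaces.Torus.gradient (δ ⋆ FunctionSpaces.Torus.kernel ε) x‖) 2 volume) := by
        gcongr
        exact h1.trans (by gcongr)
    _ = _ := by ring

end Slice


end Torus

end Literature.Analysis.FluidPDE
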